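import Literature.Claims.NS.Atarka2026
import Literature.Analysis.FluidPDE.RadialCalculus
import Literature.Analysis.FluidPDE.PressurePoisson
import Literature.Analysis.FluidPDE.SpaceTimeMollifier
import Literature.Analysis.FluidPDE.SteadyLiouvilleTsaiKit
import Literature.Analysis.FluidPDE.KNSSLemma31Caloric
import Summits.NavierStokesRegularity.NavierStokesRegularity.Theorems.SoloRefuteRozumniuk2019
import Summits.NavierStokesRegularity.NavierStokesRegularity.Theorems.LinearLiouvilleSeven.Negative.ParasiticModes
import Mathlib.MeasureTheory.Constructions.HaarToSphere
import Mathlib.MeasureTheory.Measure.Lebesgue.VolumeOfBalls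
import HarnessLib

/-!
# Solo refutation (D-0090 NS-CLAIMS, C128): Atarka, HAL hal-05563207 v1 (2026) — Step 1 fails

Cell `ns-claims`, refuter of record ns-claims-refuter-7 g0; skeleton `Literature.Claims.NS.Atarka2026`
(ns-claims-typist-12 g2, p488843). This file decides the EARLIEST on-path step of the typed chain,
**Step 1 = Prop. 2.1 (5) [PDF p.3 l.40] «`PΔu = Δu` pour `u ∈ H²(Ω) ∩ V`»** (consumed p.4 l.7 «Par la
propriété 5, `P(Δu) = Δu`» → (5) → Thm 5.1 → Thm 7.1 → Thm 8.1 → Thm 11.1), at both typed grains: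

* `not_Prop21_5orth : ¬ Prop21_5orth` — the P-free grain `∫_Ω ⟪∇q, Δu⟫ = 0` for all smooth `q` and all
  `u ∈ C^∞`, `div u = 0` in `Ω`, `u = 0` on `∂Ω`;
* `not_Prop21_5 : ¬ Prop21_5` — the projector grain, through the skeleton's `prop21_5_iff_orth`.

Countermodel (the classical fact that the Leray projector does not commute with `Δ` under the no-slip
condition — the Stokes operator is `−PΔ ≠ −Δ`): `Ω = B(0,1) ⊂ ℝ³` and, for `a ∈ ℝ³`,
`w_a(x) = (1 − |x|²)((1 − 3|x|²) a + 2⟪a, x⟫ x) = M(|x|²) a + ∇(⟪a, x⟫ K(|x|²))`,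
`M(s) = 1 − 5s + 7s²/2`, `K(s) = s − s²/2`: smooth, divergence-free on `ℝ³`, zero on the unit sphere, with
`Δw_a = (56|x|² − 20) a − 28⟪a, x⟫ x`. Pairing with `q = ⟪a, ·⟫` and summing over `a = e₁, e₂, e₃` gives
`∫_B (140|x|² − 60) dx = 32π ≠ 0` (polar coordinates), whereas Step 1 forces each summand to vanish.

Credits: `ballΩ`, `coe_ballΩ`, `gradient_normSq_sub_one`, `isAdmissibleDomain_ball` (the unit ball is an
admissible domain, `ρ = |x|² − 1`) are ns-claims-typist-12 g2's (kit `killkit-lemma34-typist12.lean`,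
sha16 2c443873ff47586f), adopted verbatim. The scalar-grain kills of Steps 8/11 (typist-12 kit #1) and the
Step 2 `Lemma34C` concentration kill (typist-12 kit #2) are filed as sibling modules.

WHAT THIS IS NOT: not a statement about the Navier–Stokes problem itself; not about any author beyond the
typed locator.
-/

noncomputable section

open Set Function MeasureTheory Metric InnerProductSpace
open scoped Topology ContDiff Laplacian RealInnerProductSpace

-- lint debt (cell convention, SoloRefute files): the Theorems namespace repeats `NavierStokesRegularity`.
set_option linter.dupNamespace false

namespace Summit.NavierStokesRegularity.NavierStokesRegularity.Theorems.Atarka2026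

open Literature.Claims.NS.Atarka2026 Literature.Analysis.FluidPDE

/-! ### Radial–linear calculus on `ℝ³` -/

/-- `Δ⟪a, ·⟫ = 0` (`∇⟪a, ·⟫ = a` is the tree's `LinearLiouvilleSeven.Negative.gradient_inner_const_left`).
[folklore] -/
theorem laplacian_innerLeft (a x : E3) : (Δ (fun y : E3 => ⟪a, y⟫)) x = 0 := by
  have hφ : ContDiff ℝ 2 (fun y : E3 => ⟪a, y⟫) := (innerSL ℝ a : E3 →L[ℝ] ℝ).contDiff
  have hg : gradient (fun y : E3 => ⟪a, y⟫) = fun _ => a := funext (LinearLiouvilleSeven.Negative.gradient_inner_const_left a)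
  rw [← divergence_gradient hφ, hg]
  simp [VectorCalculus.divergence]

/-- Gradient of `x ↦ ⟪a, x⟫ · P(‖x‖²)`: `P(‖x‖²) a + 2⟪a, x⟫ P'(‖x‖²) x`. [folklore] -/
theorem gradient_inner_mul {P P' : ℝ → ℝ} (hP : ∀ s, HasDerivAt P (P' s) s) (a x : E3) :
    gradient (fun y : E3 => ⟪a, y⟫ * P (‖y‖ ^ 2)) x =
      P (‖x‖ ^ 2) • a + (2 * ⟪a, x⟫ * P' (‖x‖ ^ 2)) • x := by
  have h1 : HasFDerivAt (fun y : E3 => ⟪a, y⟫) (innerSL ℝ a : E3 →L[ℝ] ℝ) x :=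
    (innerSL ℝ a : E3 →L[ℝ] ℝ).hasFDerivAt
  have h2 := hasFDerivAt_comp_norm_sq (E := E3) (hP (‖x‖ ^ 2))
  have h : HasFDerivAt (fun y : E3 => ⟪a, y⟫ * P (‖y‖ ^ 2))
      (⟪a, x⟫ • ((2 * P' (‖x‖ ^ 2)) • (innerSL ℝ x : E3 →L[ℝ] ℝ)) +
        P (‖x‖ ^ 2) • (innerSL ℝ a : E3 →L[ℝ] ℝ)) x := h1.mul h2
  rw [gradient, h.fderiv, map_add, map_smul, map_smul, map_smul]
  have hx : (toDual ℝ E3).symm (innerSL ℝ x : E3 →L[ℝ] ℝ) = x := (toDual ℝ E3).symm_apply_apply x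
  have ha : (toDual ℝ E3).symm (innerSL ℝ a : E3 →L[ℝ] ℝ) = a := (toDual ℝ E3).symm_apply_apply a
  rw [hx, ha, smul_smul, add_comm]
  congr 1
  ring

/-- Laplacian of `x ↦ ⟪a, x⟫ · P(‖x‖²)` on `ℝ³`: `⟪a, x⟫ (4‖x‖² P'' + 10 P')(‖x‖²)`. [folklore] -/
theorem laplacian_inner_mul {P P' P'' : ℝ → ℝ} (hP : ∀ s, HasDerivAt P (P' s) s)
    (hP' : ∀ s, HasDerivAt P' (P'' s) s) (hPs : ContDiff ℝ 2 P) (a x : E3) :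
    (Δ (fun y : E3 => ⟪a, y⟫ * P (‖y‖ ^ 2))) x =
      ⟪a, x⟫ * (4 * P'' (‖x‖ ^ 2) * ‖x‖ ^ 2 + 10 * P' (‖x‖ ^ 2)) := by
  have hχ : ContDiff ℝ 2 (fun y : E3 => ⟪a, y⟫) := (innerSL ℝ a : E3 →L[ℝ] ℝ).contDiff
  have hf : ContDiff ℝ 2 (fun y : E3 => P (‖y‖ ^ 2)) := hPs.comp (contDiff_norm_sq ℝ)
  rw [Tsai2021.laplacian_mul_eq hχ hf x, laplacian_innerLeft,
    laplacian_comp_norm_sq isOpen_univ (fun s _ => hP s) (mem_univ _) (hP' _),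
    finrank_euclideanSpace_fin]
  have e1 : ∀ i : Fin 3, fderiv ℝ (fun y : E3 => ⟪a, y⟫) x (EuclideanSpace.single i 1) =
      ⟪a, EuclideanSpace.single i 1⟫ := fun i => by
    have hd : HasFDerivAt (fun y : E3 => ⟪a, y⟫) (innerSL ℝ a : E3 →L[ℝ] ℝ) x :=
      (innerSL ℝ a : E3 →L[ℝ] ℝ).hasFDerivAt
    rw [hd.fderiv]
    rfl
  have hpar := (EuclideanSpace.basisFun (Fin 3) ℝ).sum_inner_mul_inner a x
  simp only [EuclideanSpace.basisFun_apply] at hpar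
  have hcross : ∑ i : Fin 3, fderiv ℝ (fun y : E3 => ⟪a, y⟫) x (EuclideanSpace.single i 1) *
      fderiv ℝ (fun y : E3 => P (‖y‖ ^ 2)) x (EuclideanSpace.single i 1) =
      2 * P' (‖x‖ ^ 2) * ⟪a, x⟫ := by
    simp_rw [e1, fderiv_comp_norm_sq_apply (hP _)]
    rw [← hpar, Finset.mul_sum]
    refine Finset.sum_congr rfl fun i _ => ?_
    rw [real_inner_comm x]
    ring
  rw [hcross]
  push_cast
  ring

/-- `Δ∇ = ∇Δ` on smooth scalars. [folklore] -/
theorem laplacian_gradient_comm {ψ : E3 → ℝ} (hψ : ContDiff ℝ ∞ ψ) (x : E3) :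
    (Δ (gradient ψ)) x = gradient (Δ ψ) x := by
  have h3 : ContDiff ℝ 3 ψ := hψ.of_le (by norm_cast)
  have hD : ContDiffAt ℝ 2 (fderiv ℝ ψ) x := (hψ.fderiv_right (m := 2) (by norm_cast)).contDiffAt
  rw [Rozumniuk2019.gradient_eq_comp ψ, hD.laplacian_CLM_comp_left, Function.comp_apply,
    laplacian_fderiv_eq_fderiv_laplacian h3]
  rfl

/-! ### The test fields `w_a` on the unit ball -/

/-- Radial profile of the potential: `K(s) = s − s²/2`. -/
def Kf (s : ℝ) : ℝ := s - s ^ 2 / 2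

/-- Radial profile of the constant-direction part: `M(s) = 1 − 5s + 7s²/2`. -/
def Mf (s : ℝ) : ℝ := 1 - 5 * s + 7 / 2 * s ^ 2

/-- `K' = 1 − s`. -/
theorem hasDerivAt_Kf (s : ℝ) : HasDerivAt Kf (1 - s) s := by
  have h1 : HasDerivAt (fun t : ℝ => t ^ 2 / 2) ((2 : ℕ) * s ^ (2 - 1) / 2) s :=
    (hasDerivAt_pow 2 s).div_const 2
  have h : HasDerivAt (fun t : ℝ => t - t ^ 2 / 2) (1 - (2 : ℕ) * s ^ (2 - 1) / 2) s :=
    (hasDerivAt_id' s).sub h1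
  refine h.congr_deriv ?_
  norm_num

/-- `M' = 7s − 5`. -/
theorem hasDerivAt_Mf (s : ℝ) : HasDerivAt Mf (7 * s - 5) s := by
  have h1 : HasDerivAt (fun t : ℝ => 1 - 5 * t) (-(5 * 1)) s :=
    ((hasDerivAt_id' s).const_mul (5 : ℝ)).const_sub 1
  have h2 : HasDerivAt (fun t : ℝ => 7 / 2 * t ^ 2) (7 / 2 * ((2 : ℕ) * s ^ (2 - 1))) s :=
    (hasDerivAt_pow 2 s).const_mul (7 / 2)
  have h : HasDerivAt (fun t : ℝ => 1 - 5 * t + 7 / 2 * t ^ 2)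
      (-(5 * 1) + 7 / 2 * ((2 : ℕ) * s ^ (2 - 1))) s := h1.add h2
  refine h.congr_deriv ?_
  norm_num
  ring

/-- `R(s) = 10 − 14s` (so that `Δφ_a = ⟪a, ·⟫ R(‖·‖²)`). -/
def Rf (s : ℝ) : ℝ := 10 - 14 * s

/-- `R' = −14`. -/
theorem hasDerivAt_Rf (s : ℝ) : HasDerivAt Rf (-14) s := by
  have h : HasDerivAt (fun t : ℝ => 10 - 14 * t) (-(14 * 1)) s :=
    ((hasDerivAt_id' s).const_mul (14 : ℝ)).const_sub 10
  refine h.congr_deriv ?_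
  norm_num

/-- `K` is smooth. -/
theorem contDiff_Kf : ContDiff ℝ ∞ Kf := by
  unfold Kf; fun_prop

/-- `M` is smooth. -/
theorem contDiff_Mf : ContDiff ℝ ∞ Mf := by
  unfold Mf; fun_prop

/-- The potential `φ_a(x) = ⟪a, x⟫ K(‖x‖²)`. -/
def phi (a : E3) : E3 → ℝ := fun x => ⟪a, x⟫ * Kf (‖x‖ ^ 2)

/-- The test field `w_a(x) = M(‖x‖²) a + ∇φ_a(x)` (`= (1 − ‖x‖²)((1 − 3‖x‖²) a + 2⟪a, x⟫ x)`). -/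
def wfld (a : E3) : E3 → E3 := fun x => Mf (‖x‖ ^ 2) • a + gradient (phi a) x

/-- `φ_a` is smooth. -/
theorem contDiff_phi (a : E3) : ContDiff ℝ ∞ (phi a) :=
  ((innerSL ℝ a : E3 →L[ℝ] ℝ).contDiff).mul (contDiff_Kf.comp (contDiff_norm_sq ℝ))

/-- `x ↦ M(‖x‖²)` is smooth. -/
theorem contDiff_Mf_norm_sq : ContDiff ℝ ∞ (fun x : E3 => Mf (‖x‖ ^ 2)) :=
  contDiff_Mf.comp (contDiff_norm_sq ℝ)

/-- `∇φ_a(x) = K(‖x‖²) a + 2⟪a, x⟫(1 − ‖x‖²) x`. -/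
theorem gradient_phi (a x : E3) :
    gradient (phi a) x = Kf (‖x‖ ^ 2) • a + (2 * ⟪a, x⟫ * (1 - ‖x‖ ^ 2)) • x :=
  gradient_inner_mul hasDerivAt_Kf a x

/-- `Δφ_a(x) = ⟪a, x⟫ (10 − 14‖x‖²)`. -/
theorem laplacian_phi (a : E3) : Δ (phi a) = fun x : E3 => ⟪a, x⟫ * Rf (‖x‖ ^ 2) := by
  funext x
  have h := laplacian_inner_mul (P'' := fun _ => (-1 : ℝ)) hasDerivAt_Kf
    (fun s => (hasDerivAt_id' s).const_sub (1 : ℝ)) (contDiff_Kf.of_le (by norm_cast)) a x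
  rw [show phi a = fun y : E3 => ⟪a, y⟫ * Kf (‖y‖ ^ 2) from rfl, h]
  simp only [Rf]
  ring

/-- `w_a` is smooth. -/
theorem contDiff_wfld (a : E3) : ContDiff ℝ ∞ (wfld a) :=
  (contDiff_Mf_norm_sq.smul contDiff_const).add (Rozumniuk2019.contDiff_gradient (contDiff_phi a))

/-- `∇ · w_a = 0` everywhere. -/
theorem divergence_wfld (a x : E3) : VectorCalculus.divergence (wfld a) x = 0 := by
  have hM : DifferentiableAt ℝ (fun y : E3 => Mf (‖y‖ ^ 2)) x :=
    (contDiff_Mf_norm_sq.differentiable (by norm_cast)) x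
  have hG : DifferentiableAt ℝ (gradient (phi a)) x :=
    ((Rozumniuk2019.contDiff_gradient (contDiff_phi a)).differentiable (by norm_cast)) x
  show VectorCalculus.divergence (fun y : E3 => Mf (‖y‖ ^ 2) • a + gradient (phi a) y) x = 0
  rw [divergence_add_apply (hM.smul_const a) hG, divergence_smul_const a hM,
    fderiv_comp_norm_sq_apply (hasDerivAt_Mf _),
    divergence_gradient ((contDiff_phi a).of_le (by norm_cast)), laplacian_phi, real_inner_comm a x]
  simp only [Rf]
  ring

/-- `w_a` vanishes on the unit sphere. -/
theorem wfld_eq_zero_of_norm (a : E3) {x : E3} (hx : ‖x‖ = 1) : wfld a x = 0 := by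
  show Mf (‖x‖ ^ 2) • a + gradient (phi a) x = 0
  rw [gradient_phi, hx, ← add_assoc, ← add_smul]
  norm_num [Mf, Kf]

/-- `Δw_a(x) = (56‖x‖² − 20) a − 28⟪a, x⟫ x`. -/
theorem laplacian_wfld (a x : E3) :
    (Δ (wfld a)) x = (56 * ‖x‖ ^ 2 - 20) • a + (-(28 * ⟪a, x⟫)) • x := by
  have e : wfld a = (fun y : E3 => Mf (‖y‖ ^ 2) • a) + gradient (phi a) := rfl
  have h1 : ContDiffAt ℝ 2 (fun y : E3 => Mf (‖y‖ ^ 2) • a) x :=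
    ((contDiff_Mf_norm_sq.smul contDiff_const).of_le (by norm_cast)).contDiffAt
  have h2 : ContDiffAt ℝ 2 (gradient (phi a)) x :=
    ((Rozumniuk2019.contDiff_gradient (contDiff_phi a)).of_le (by norm_cast)).contDiffAt
  rw [e, h1.laplacian_add h2, laplacian_smul_const (contDiff_Mf_norm_sq.of_le (by norm_cast)),
    laplacian_comp_norm_sq (g₂ := (7 : ℝ)) isOpen_univ (fun s _ => hasDerivAt_Mf s) (mem_univ _)
      (by simpa using ((hasDerivAt_id' (‖x‖ ^ 2)).const_mul (7 : ℝ)).sub_const (5 : ℝ)),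
    finrank_euclideanSpace_fin, laplacian_gradient_comm (contDiff_phi a), laplacian_phi,
    gradient_inner_mul hasDerivAt_Rf a x]
  simp only [Rf]
  push_cast
  module

/-- The pairing of `Δw_a` with `∇⟪a, ·⟫ = a`: `(56‖x‖² − 20)‖a‖² − 28⟪a, x⟫²`. -/
theorem inner_gradient_laplacian_wfld (a x : E3) :
    ⟪gradient (fun y : E3 => ⟪a, y⟫) x, (Δ (wfld a)) x⟫ =
      (56 * ‖x‖ ^ 2 - 20) * ‖a‖ ^ 2 - 28 * ⟪a, x⟫ ^ 2 := by
  rw [LinearLiouvilleSeven.Negative.gradient_inner_const_left, laplacian_wfld, inner_add_right, inner_smul_right, inner_smul_right,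
    real_inner_self_eq_norm_sq]
  ring

/-! ### The unit ball is an admissible domain (ns-claims-typist-12 g2, kit `killkit-lemma34-typist12.lean`) -/

/-- The open unit ball of `ℝ³` as an `Opens`. -/
def ballΩ : TopologicalSpace.Opens E3 := ⟨ball (0 : E3) 1, isOpen_ball⟩

/-- Its carrier is the unit ball. -/
theorem coe_ballΩ : (ballΩ : Set E3) = ball (0 : E3) 1 := rfl

/-- `∇(‖x‖² − 1) = 2x`. [folklore] -/
theorem gradient_normSq_sub_one (x : E3) :
    gradient (fun y : E3 => ‖y‖ ^ 2 - 1) x = (2 : ℝ) • x := by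
  have h := ((hasStrictFDerivAt_norm_sq x).hasFDerivAt).sub_const (1 : ℝ)
  rw [gradient, h.fderiv, two_nsmul, map_add, two_smul]
  have hx : (InnerProductSpace.toDual ℝ E3).symm (innerSL ℝ x) = x :=
    (InnerProductSpace.toDual ℝ E3).symm_apply_apply x
  rw [hx]

/-- The unit ball is an admissible domain (`ρ(x) = ‖x‖² − 1`). -/
theorem isAdmissibleDomain_ball : IsAdmissibleDomain ballΩ where
  bounded := isBounded_ball
  nonempty := ⟨0, mem_ball_self one_pos⟩
  connected := (convex_ball (0 : E3) 1).isConnected ⟨0, mem_ball_self one_pos⟩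
  regular := by
    refine ⟨fun x => ‖x‖ ^ 2 - 1, (contDiff_norm_sq ℝ).sub contDiff_const, ?_, ?_⟩
    · ext x
      simp only [coe_ballΩ, mem_ball, dist_zero_right, mem_setOf_eq]
      constructor
      · intro h; nlinarith [norm_nonneg x]
      · intro h; nlinarith [norm_nonneg x]
    · intro x hx h0
      rw [gradient_normSq_sub_one] at h0
      have hx0 : x = 0 := by
        rcases smul_eq_zero.mp h0 with h | h
        · norm_num at h
        · exact h
      subst hx0
      norm_num at hx

/-- `w_a ∈ H²(B) ∩ V` at the typed grain: smooth, divergence-free, no-slip on the unit sphere. -/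
theorem isVField_wfld (a : E3) : IsVField ballΩ (wfld a) where
  smooth := contDiff_wfld a
  divFree := fun x _ => divergence_wfld a x
  noSlip := fun x hx => by
    rw [coe_ballΩ, frontier_ball (0 : E3) one_ne_zero, mem_sphere_zero_iff_norm] at hx
    exact wfld_eq_zero_of_norm a hx

/-! ### The ball moment `∫_B (140‖x‖² − 60) dx = 32π ≠ 0` -/

/-- `∫_{B(0,1)} (140‖x‖² − 60) dx = 32π` (polar coordinates, `|B(0,1)| = 4π/3`). [folklore] -/
theorem integral_ball_moment : ∫ x in ball (0 : E3) 1, (140 * ‖x‖ ^ 2 - 60) = 32 * Real.pi := by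
  set g : ℝ → ℝ := fun r => if r < 1 then 140 * r ^ 2 - 60 else 0 with hg
  have hind : (ball (0 : E3) 1).indicator (fun x : E3 => 140 * ‖x‖ ^ 2 - 60) = fun x => g ‖x‖ := by
    funext x
    by_cases hx : x ∈ ball (0 : E3) 1
    · rw [Set.indicator_of_mem hx]
      rw [mem_ball_zero_iff] at hx
      simp [hg, hx]
    · rw [Set.indicator_of_notMem hx]
      rw [mem_ball_zero_iff, not_lt] at hx
      simp [hg, not_lt.2 hx]
  have hrad : ∀ r ∈ Ioi (0 : ℝ), r ^ (3 - 1) • g r =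
      (Iio (1 : ℝ)).indicator (fun r => 140 * r ^ 4 - 60 * r ^ 2) r := by
    intro r _
    by_cases h1 : r < 1
    · rw [Set.indicator_of_mem (show r ∈ Iio (1 : ℝ) from h1), smul_eq_mul]
      simp only [hg, if_pos h1]
      ring
    · rw [Set.indicator_of_notMem (show r ∉ Iio (1 : ℝ) from h1), smul_eq_mul]
      simp [hg, if_neg h1]
  have hdim : Module.finrank ℝ E3 = 3 := finrank_euclideanSpace_fin
  have hball : (volume : Measure E3).real (ball 0 1) = Real.pi * 4 / 3 := by
    rw [Measure.real, EuclideanSpace.volume_ball_fin_three, ENNReal.ofReal_one, one_pow, one_mul,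
      ENNReal.toReal_ofReal (by positivity)]
  have hI : ∫ r in Ioo (0 : ℝ) 1, (140 * r ^ 4 - 60 * r ^ 2) = 8 := by
    rw [← integral_Ioc_eq_integral_Ioo, ← intervalIntegral.integral_of_le zero_le_one,
      intervalIntegral.integral_sub, intervalIntegral.integral_const_mul,
      intervalIntegral.integral_const_mul, integral_pow, integral_pow]
    · norm_num
    · exact (continuous_const.mul (continuous_pow 4)).intervalIntegrable _ _
    · exact (continuous_const.mul (continuous_pow 2)).intervalIntegrable _ _
  rw [← integral_indicator measurableSet_ball, hind, integral_fun_norm_addHaar volume g, hdim, hball,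
    setIntegral_congr_fun measurableSet_Ioi hrad, setIntegral_indicator measurableSet_Iio,
    Set.Ioi_inter_Iio, hI, smul_eq_mul, nsmul_eq_mul]
  push_cast
  ring

/-- Each single-direction integrand is integrable on the ball. -/
theorem integrableOn_pairing (a : E3) :
    IntegrableOn (fun x : E3 => (56 * ‖x‖ ^ 2 - 20) * ‖a‖ ^ 2 - 28 * ⟪a, x⟫ ^ 2) (ball (0 : E3) 1) := by
  have hc : Continuous fun x : E3 => (56 * ‖x‖ ^ 2 - 20) * ‖a‖ ^ 2 - 28 * ⟪a, x⟫ ^ 2 := by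
    fun_prop
  exact (hc.continuousOn.integrableOn_compact (isCompact_closedBall (0 : E3) 1)).mono_set
    ball_subset_closedBall

/-- Summing the three coordinate directions: `Σᵢ [(56‖x‖² − 20) − 28 xᵢ²] = 140‖x‖² − 60`. -/
theorem sum_pairing_single (x : E3) :
    ∑ i : Fin 3, ((56 * ‖x‖ ^ 2 - 20) * ‖EuclideanSpace.single i (1 : ℝ)‖ ^ 2 -
      28 * ⟪EuclideanSpace.single i (1 : ℝ), x⟫ ^ 2) = 140 * ‖x‖ ^ 2 - 60 := by
  have hn : ∀ i : Fin 3, ‖EuclideanSpace.single i (1 : ℝ)‖ = 1 := fun i => by simp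
  simp only [hn, EuclideanSpace.inner_single_left, one_pow, mul_one, map_one, one_mul]
  rw [EuclideanSpace.real_norm_sq_eq x, Fin.sum_univ_three, Fin.sum_univ_three]
  ring

/-! ### Step 1 fails: `PΔu ≠ Δu` on `H²(B) ∩ V` -/

/-- **Step 1 [Prop. 2.1 (5), PDF p.3 l.40] is false at its P-free grain**: on the unit ball `B ⊂ ℝ³`
the fields `w_a = (1 − |x|²)((1 − 3|x|²) a + 2⟪a, x⟫ x) ∈ C^∞ ∩ {div = 0 in B} ∩ {w = 0 on ∂B}` have
`Δw_a = (56|x|² − 20) a − 28⟪a, x⟫ x`, and with `q = ⟪a, ·⟫`: `Σ_{a = e₁,e₂,e₃} ∫_B ⟪∇q, Δw_a⟫ =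
∫_B (140|x|² − 60) = 32π ≠ 0`, so `Δu ⊥ ∇q` fails for some `u ∈ H² ∩ V` (the Leray projector does
not commute with the Laplacian under no-slip; `PΔ ≠ Δ`, the Stokes operator is not `−Δ`). -/
theorem not_Prop21_5orth : ¬ Literature.Claims.NS.Atarka2026.Prop21_5orth := by
  intro h
  have key : ∀ a : E3,
      ∫ x in ball (0 : E3) 1, ((56 * ‖x‖ ^ 2 - 20) * ‖a‖ ^ 2 - 28 * ⟪a, x⟫ ^ 2) = 0 := by
    intro a
    have h1 := h ballΩ isAdmissibleDomain_ball (wfld a) (isVField_wfld a) (fun y : E3 => ⟪a, y⟫)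
      (innerSL ℝ a : E3 →L[ℝ] ℝ).contDiff
    rw [coe_ballΩ] at h1
    simpa only [inner_gradient_laplacian_wfld] using h1
  have hsum : ∫ x in ball (0 : E3) 1, (140 * ‖x‖ ^ 2 - 60) = 0 := by
    calc ∫ x in ball (0 : E3) 1, (140 * ‖x‖ ^ 2 - 60)
        = ∫ x in ball (0 : E3) 1, ∑ i : Fin 3, ((56 * ‖x‖ ^ 2 - 20) *
            ‖EuclideanSpace.single i (1 : ℝ)‖ ^ 2 - 28 * ⟪EuclideanSpace.single i (1 : ℝ), x⟫ ^ 2) := by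
          refine setIntegral_congr_fun measurableSet_ball fun x _ => ?_
          exact (sum_pairing_single x).symm
      _ = ∑ i : Fin 3, ∫ x in ball (0 : E3) 1, ((56 * ‖x‖ ^ 2 - 20) *
            ‖EuclideanSpace.single i (1 : ℝ)‖ ^ 2 - 28 * ⟪EuclideanSpace.single i (1 : ℝ), x⟫ ^ 2) :=
          integral_finsetSum _ fun i _ => integrableOn_pairing _
      _ = 0 := Finset.sum_eq_zero fun i _ => key _
  rw [integral_ball_moment] at hsum
  have : (0 : ℝ) < 32 * Real.pi := by positivity
  linarith

/-- **Step 1 [Prop. 2.1 (5), PDF p.3 l.40] `PΔu = Δu pour u ∈ H² ∩ V` is false** (projector grain, via the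
skeleton's `prop21_5_iff_orth`). -/
theorem not_Prop21_5 : ¬ Literature.Claims.NS.Atarka2026.Prop21_5 :=
  fun h => not_Prop21_5orth (prop21_5_iff_orth.1 h)

end Summit.NavierStokesRegularity.NavierStokesRegularity.Theorems.Atarka2026

end
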